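/-
Copyright: statement-level skeleton of a published paper (lit-balaban cell, Phase-2 proof seat p20 gen 8). No proof claims
beyond what the kernel checks below.
-/
import Literature.MathematicalPhysics.QuantumFieldTheory.Balaban1983to89.B3MxiFubiniBound
import Literature.MathematicalPhysics.QuantumFieldTheory.Balaban1983to89.B3Eq322PositiveDegree
import Literature.MathematicalPhysics.QuantumFieldTheory.Balaban1983to89.B3CxiTadpoleLimit

/-!
# B3 — T. Bałaban, *(Higgs)₂,₃ quantum fields in a finite volume. III. Renormalization*, CMP **88** (1983) 411–445
[Balaban1983Higgs3], p. 438 [PDF 28]: **"ηG_k(x,x) is convergent to some finite constant as η → 0"** — the LIMIT itself,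
PROVED for the zero-field torus propagator `G_k(T,0)` (`d = 3`), uniformly in the volume, with the constant identified:
`ηG_k(x,x) → K₃ = (2π)^{−3}∫_{|q_μ|≤π} dq/Δ¹(q)`, the same constant as for the free propagator `C^ξ`

statement-level skeleton of published theorems with citation tags; proofs where landed; nothing here is a claim about
the Yang–Mills mass gap

PDF held: `paper:balaban1983-higgs-2-3-quantum-fields-finite-volume` (journal page = PDF page + 410); p. 438 [PDF 28] and p. 412
[PDF 2] ((1.1) `η = L^{−k}`) read in the OCR texts `p0028.txt`, `p0002.txt` and on the render
`run/shared/lean/pub/pub-balaban/b2b-balaban-ref1/pages/1983-cmp88-higgs23-III/1983-cmp88-higgs23-III-p028-x4.png`.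

CITATION HEADER (lean-in-tree rule).  Part of the lit-balaban TYPED SKELETON (HOME `run/shared/lean/pub/lit-balaban/`), PHASE 2,
seat p20 generation 8.  WHAT IS REPRODUCED: row **B3.Eq3.21-3.24** of `HOME/lit-balaban-r15/ROWS-B3.md` (fold owner r15), the
owner's outstanding item (ii) of v1.69: *"the LIMIT half of «ηG_k(x,x) is convergent to some finite constant as η → 0» for the
torus G_k(0) itself (boundedness proved; the limit proved for C^ξ, `B3CxiTadpoleLimit`)"*.

THE PRINTED TEXT (verbatim, p. 438).  *"We have to consider another class of graphs with two external scalar field legs, the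
graphs with one leg differentiated. There are only two such graphs: (3.21). The expression corresponding to the first graph is
in fact convergent, because ηG_k(x,x) is convergent to some finite constant as η → 0."*  Here `η = L^{−k}` ((1.1) p. 412: the
fields after `k` steps live on the `η`-lattice, `η = L^{−k}`), so **`η → 0` is the limit `k → ∞`** (and with it `K ≥ k → ∞`,
`ε = L^{−K} → 0`): the ultraviolet limit of the coincident-point value of the propagator times one power of the spacing, in
`d = 3`.  It is NOT a limit at fixed `k`.

THE TREE'S DICTIONARY.  The Sect.-3 carriers of the tree write the paper's `η`-lattice expressions on the finest torus `T^{(0)}`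
with spacing `ε` (`Params.eps`) and the RESCALED objects with `ξ = L^{−k}` (`Params.eta k`); p39 g6's `B3GkZeroTorusRescaled.G0xi
P a msq k` is the `ξ^d`-normalised kernel of `(L^kε)^{−2}G_k(T_ε,0) = (−Δ^ξ + (L^kε)²m² + a_kP_k)^{−1}` — the paper's `G_k(0)` on
its `η`-lattice — so that **the paper's `ηG_k(x,x)` is `Params.eta k · G0xi P a msq k x x`** (p18 g8
`B3Eq322PositiveDegree.eps_mul_sum_gpiece_diag`: `ε·(Σ_{i<k}G^η_{(i)})(x,x) = ξ·G^ξ_k(0;x,x)`, `d = 3`), whose BOUNDEDNESS uniformly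
in the volume and the scale is p39 g6's `eta_mul_abs_G0xi_diag_le`.

THE PROOF (ours; the paper gives none).  Three inputs BY NAME:
* the (3.16) split `G^ξ_k(0) = C^ξ_T + M` at the diagonal (p39 g6 `B3Eq316ResolventZeroTorus.Mxi`), with p39 g7's uniform
  bound `|M(y,y′)| ≤ C_M` (`B3MxiFubiniBound.Mxi_profiles`) ⇒ `ξ·|M(y,y)| ≤ C_M·ξ`;
* the torus ↔ `ξℤ³` comparison AT THE DIAGONAL: `C^ξ_T(y,y) = Σ'_{n∈ℤ³}C^ξ(N·n) = C^ξ(0) + Σ'_{n≠0}C^ξ(N·n)` and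
  `0 ≤ Σ'_{n≠0}C^ξ(N·n) ≤ 472500` for `ξN ≥ 1` (the physical side of the rescaled torus is `≥ 1`; the coset terms sit at physical
  distance `≥ ξN|n|_∞ ≥ 1`: p39 g5's `B3Eq324Torus` coset bound and p03's `B3CxiTorusBound.sum_prod_le`) ⇒
  `|ξC^ξ_T(y,y) − ξC^ξ(0)| ≤ 472500·ξ`;
* p20 g4's `B3CxiTadpoleLimit.tendsto_xi_mul_Cxi_zero_three`: `ξ·C^ξ(0) → K₃ := (2π)^{−3}∫_{|q_μ|≤π}dq/Δ¹(q)` as `ξ → 0⁺`, with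
  `K₃ ∈ [1/12, 3(π+1)/(4π)]` (`tadpoleConst_mem_Icc`).
Hence `|ηG_k(y,y) − η·C^η(0)| ≤ (472500 + C_M)·η` for ALL volumes `P = (3, L, m, K)`, all `1 ≤ k ≤ K`, all `y`
(**`abs_eta_mul_G0xi_diag_sub_le`**), and therefore **`eta_mul_G0xi_diag_tendsto`**: for every `e > 0` there is `k₀` such that
`|ηG_k(y,y) − K₃| < e` for every volume, every `k₀ ≤ k ≤ K` and every site — the printed sentence, uniformly in the volume, with
the constant identified (and non-zero); `eta_mul_G0xi_diag_convergent` is the printed shape *"convergent to SOME finite constant"*.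
§4 transports both to the tower on the finest torus (`eps_mul_Gk_diag_tendsto`, p18's dictionary) and §5 to the expression of the
first graph of (3.21) (p18 g8's `expr321a`): *"The expression corresponding to the first graph is in fact convergent"* — the vertex
function `ηG_k(x,x)g(x)` is within `e` (resp. `C·η`) of the LOCAL vertex `K₃·g(x)` (resp. `ηC^η(0)·g(x)`):
**`expr321a_zero_torus_tendsto`**, `abs_expr321a_sub_free_le`.

HONEST SCOPE: the model instance `A = B̃ = 0`, `U ≡ 1`, `Ω` = the whole torus, `d = 3` (the scope of every zero-torus file of
rows B3.Eq2.10 / 3.11-3.17 / 3.21-3.24); no rate for `ξC^ξ(0) → K₃` is claimed here (only the `O(η)` comparison with the free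
tadpole); `d = 2` not treated (there `ηG_k(x,x) → 0`, cf. `tendsto_xi_mul_Cxi_zero_two`).  Mathlib + the cited tree files only;
theorems only — no `def`, no named fact, no `sorry`; standard axioms.  Unit `lit-balaban-p20-g8` (Phase-2 proof seat p20, gen 8),
HOME `run/shared/lean/pub/lit-balaban/`, 2026-08-21.
-/

open scoped BigOperators RealInnerProductSpace Topology
open Filter

namespace Literature.MathematicalPhysics.QuantumFieldTheory.Balaban1983to89.B3GkTadpoleLimitZeroTorus

open Finset B1RG242Torus B3GkZeroTorusRescaled B3Eq316ResolventZeroTorus B3MxiFubiniBound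
open LatticeFieldCalculus B3Sect3ScalarSelfEnergy B3Sect3VectorSelfEnergy B3CxiPropagator B3CxiTorusBound
open B3CxiComparisonBound B3CxiUniformBound B3CxiTorusDerivativeBound B3CxiTadpole B3CxiTadpoleLimit
open B3Sect3KernelsZeroTorus B3Eq322OneLegDifferentiated B3Eq322PositiveDegree
open _root_.MeasureTheory _root_.Filter _root_.Set

noncomputable section

universe u

/-! ## §1 The torus free propagator at the diagonal versus `C^ξ(0)` on `ξℤ³` -/

section Wrap

/-- kernel: `(1 + 2/(1 − e^{−1/6}))³ ≤ 3375` (`e^{−1/6} ≤ 6/7`). [folklore] -/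
private theorem geomConst_le : (1 + 2 / (1 - Real.exp (-(1 / 6)))) ^ 3 ≤ 3375 := by
  have h1 : Real.exp (-(1 / 6)) ≤ 6 / 7 := by
    have h := Real.add_one_le_exp (1 / 6 : ℝ)
    rw [Real.exp_neg, inv_le_comm₀ (Real.exp_pos _) (by norm_num)]
    linarith
  have h2 : 0 < 1 - Real.exp (-(1 / 6)) := by linarith
  have h3 : 2 / (1 - Real.exp (-(1 / 6))) ≤ 14 := by
    rw [div_le_iff₀ h2]; linarith
  have h4 : 0 ≤ 1 + 2 / (1 - Real.exp (-(1 / 6))) := by positivity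
  calc (1 + 2 / (1 - Real.exp (-(1 / 6)))) ^ 3 ≤ (15 : ℝ) ^ 3 := pow_le_pow_left₀ h4 (by linarith) 3
    _ = 3375 := by norm_num

/-- kernel (p39 g5's private `B3Eq324Torus.Cxi_cosetPt_zero_le`, re-proved here): the coset term of the diagonal for `n ≠ 0`
(d = 3, `0 < ξ ≤ 1`, `ξN ≥ 1`): `C^ξ(N·n) ≤ 140·Π_μ q^{(|n_μ|−1)⁺}`, `q = e^{−1/6}` — the point `N·n` lies at physical distance
`ξN|n|_∞ ≥ 1`. [cite: Balaban1983Higgs3, (3.16) p.437] -/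
private theorem Cxi_cosetPt_zero_le {ξ : ℝ} (hξ : 0 < ξ) (hξ1 : ξ ≤ 1) {N : ℕ} (hN : 1 ≤ ξ * N) {n : ZSite 3}
    (hn : n ≠ 0) :
    Cxi 3 ξ (cosetPt N 0 n) ≤ 140 * ∏ μ : Fin 3, Real.exp (-(1 / 6)) ^ ((n μ).natAbs - 1) := by
  have hex : ∃ μ : Fin 3, n μ ≠ 0 := by
    by_contra h
    push Not at h
    exact hn (funext h)
  obtain ⟨ν, hν⟩ := hex
  have hN1 : (1 : ℝ) ≤ N := hN.trans (mul_le_of_le_one_left (Nat.cast_nonneg N) hξ1)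
  have hNne : N ≠ 0 := by
    rintro rfl
    norm_num at hN1
  set x := cosetPt N 0 n with hx
  have hxν : x ν = N * n ν := by rw [hx, cosetPt_apply, Pi.zero_apply, zero_add]
  have hx0 : x ≠ 0 := by
    intro h0
    have h00 : x ν = 0 := by rw [h0]; rfl
    rw [hxν] at h00
    rcases mul_eq_zero.mp h00 with h | h
    · exact hNne (by exact_mod_cast h)
    · exact hν h
  have hNx : (N : ℝ) ≤ supn x := by
    have h2 : ((x ν).natAbs : ℝ) ≤ supn x := by rw [← supZ_three]; exact natAbs_le_supZ x ν
    have h3 : (x ν).natAbs = N * (n ν).natAbs := by rw [hxν, Int.natAbs_mul, Int.natAbs_natCast]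
    have h4 : (1 : ℝ) ≤ (n ν).natAbs := by exact_mod_cast Int.natAbs_pos.2 hν
    have h5 : (N : ℝ) ≤ ((x ν).natAbs : ℝ) := by
      rw [h3, Nat.cast_mul]
      nlinarith [Nat.cast_nonneg (α := ℝ) N]
    exact h5.trans h2
  have h1 := Cxi_three_le_sup hξ hξ1 x hx0
  rw [← supn_eq_supNorm] at h1
  have hzN : ∀ μ : Fin 3, 2 * ((0 : ZSite 3) μ).natAbs ≤ N := fun μ => by simp
  have hE := exp_cosetPt_le hξ.le hzN n
  rw [← hx] at hE
  have h1fac : Real.exp (-(1 / 2 * (ξ * supn (0 : ZSite 3)))) ≤ 1 := by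
    have hs0 : (0 : ℝ) ≤ supn (0 : ZSite 3) := by unfold supn; exact Nat.cast_nonneg _
    exact Real.exp_le_one_iff.mpr (by nlinarith [hξ.le])
  have hq : Real.exp (-(ξ * N / 6)) ≤ Real.exp (-(1 / 6)) := Real.exp_le_exp.2 (by linarith)
  have hq0 : 0 ≤ Real.exp (-(ξ * N / 6)) := (Real.exp_pos _).le
  have hprod : ∏ μ : Fin 3, Real.exp (-(ξ * N / 6)) ^ ((n μ).natAbs - 1) ≤
      ∏ μ : Fin 3, Real.exp (-(1 / 6)) ^ ((n μ).natAbs - 1) :=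
    Finset.prod_le_prod (fun μ _ => pow_nonneg hq0 _) fun μ _ => pow_le_pow_left₀ hq0 hq _
  have hP1 : 0 ≤ ∏ μ : Fin 3, Real.exp (-(ξ * N / 6)) ^ ((n μ).natAbs - 1) :=
    Finset.prod_nonneg fun μ _ => pow_nonneg hq0 _
  have hexp : Real.exp (-(ξ * supn x / 2)) ≤ ∏ μ : Fin 3, Real.exp (-(1 / 6)) ^ ((n μ).natAbs - 1) := by
    have hre : Real.exp (-(ξ * supn x / 2)) = Real.exp (-(1 / 2 * (ξ * supn x))) := by
      congr 1; ring
    rw [hre]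
    calc Real.exp (-(1 / 2 * (ξ * supn x)))
        ≤ Real.exp (-(1 / 2 * (ξ * supn (0 : ZSite 3)))) * ∏ μ : Fin 3, Real.exp (-(ξ * N / 6)) ^ ((n μ).natAbs - 1) := hE
      _ ≤ 1 * ∏ μ : Fin 3, Real.exp (-(1 / 6)) ^ ((n μ).natAbs - 1) := mul_le_mul h1fac hprod hP1 zero_le_one
      _ = _ := one_mul _
  have hden : 1 ≤ ξ * supn x := hN.trans (mul_le_mul_of_nonneg_left hNx hξ.le)
  calc Cxi 3 ξ x ≤ 140 * Real.exp (-(ξ * supn x / 2)) / (ξ * supn x) := h1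
    _ ≤ 140 * Real.exp (-(ξ * supn x / 2)) / 1 :=
        div_le_div_of_nonneg_left (by positivity) one_pos hden
    _ ≤ 140 * ∏ μ : Fin 3, Real.exp (-(1 / 6)) ^ ((n μ).natAbs - 1) := by
        rw [div_one]; exact mul_le_mul_of_nonneg_left hexp (by norm_num)

/-- kernel: the `n ≠ 0` coset terms of the diagonal have a finite sum bounded by an absolute constant:
`Σ_{n∈F, n≠0}C^ξ(N·n) ≤ 140·(1 + 2/(1 − e^{−1/6}))³ ≤ 472500` (d = 3, `0 < ξ ≤ 1`, `ξN ≥ 1`). [cite: Balaban1983Higgs3, (3.16) p.437] -/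
private theorem sum_ite_coset_le {ξ : ℝ} (hξ : 0 < ξ) (hξ1 : ξ ≤ 1) {N : ℕ} (hN : 1 ≤ ξ * N) (F : Finset (ZSite 3)) :
    ∑ n ∈ F, (if n = 0 then (0 : ℝ) else Cxi 3 ξ (cosetPt N 0 n)) ≤ 472500 := by
  classical
  have hq0 : 0 ≤ Real.exp (-(1 / 6)) := (Real.exp_pos _).le
  have hq1 : Real.exp (-(1 / 6)) < 1 := Real.exp_lt_one_iff.2 (by norm_num)
  calc ∑ n ∈ F, (if n = 0 then (0 : ℝ) else Cxi 3 ξ (cosetPt N 0 n))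
      ≤ ∑ n ∈ F, 140 * ∏ μ : Fin 3, Real.exp (-(1 / 6)) ^ ((n μ).natAbs - 1) := by
        refine Finset.sum_le_sum fun n _ => ?_
        split_ifs with hn
        · exact mul_nonneg (by norm_num) (Finset.prod_nonneg fun μ _ => pow_nonneg hq0 _)
        · exact Cxi_cosetPt_zero_le hξ hξ1 hN hn
    _ = 140 * ∑ n ∈ F, ∏ μ : Fin 3, Real.exp (-(1 / 6)) ^ ((n μ).natAbs - 1) := by rw [Finset.mul_sum]
    _ ≤ 140 * 3375 := mul_le_mul_of_nonneg_left ((sum_prod_le hq0 hq1 _).trans geomConst_le) (by norm_num)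
    _ = 472500 := by norm_num

/-- **The periodization of `C^ξ` at the diagonal** (d = 3, `0 < ξ ≤ 1`, physical period `ξN ≥ 1`): the torus sum `Σ'_{n∈ℤ³}C^ξ(N·n)`
exceeds its `n = 0` term `C^ξ(0)` — the `ξℤ³` tadpole — by the wrap-around terms, which are nonnegative and bounded by an absolute
constant: `0 ≤ Σ'_nC^ξ(N·n) − C^ξ(0) ≤ 472500`, uniformly in `ξ` and `N` (whereas `C^ξ(0)` itself is of size `ξ^{−1}`).
[cite: Balaban1983Higgs3, (3.21) p.438] -/
theorem perCxi_zero_sub_Cxi_zero {d : ℕ} (hd : d = 3) {ξ : ℝ} (hξ : 0 < ξ) (hξ1 : ξ ≤ 1) {N : ℕ} (hN : 1 ≤ ξ * N) :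
    0 ≤ perCxi d ξ N 0 - Cxi d ξ 0 ∧ perCxi d ξ N 0 - Cxi d ξ 0 ≤ 472500 := by
  subst hd
  classical
  have hN1 : (1 : ℝ) ≤ N := hN.trans (mul_le_of_le_one_left (Nat.cast_nonneg N) hξ1)
  have hNne : N ≠ 0 := by
    rintro rfl
    norm_num at hN1
  have hs : Summable fun n : ZSite 3 => Cxi 3 ξ (cosetPt N 0 n) := summable_coset hξ hNne 0
  have h00 : cosetPt N (0 : ZSite 3) (0 : ZSite 3) = 0 := by
    funext μ; simp [cosetPt_apply]
  have hsplit : perCxi 3 ξ N 0 =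
      Cxi 3 ξ 0 + ∑' n : ZSite 3, (if n = 0 then (0 : ℝ) else Cxi 3 ξ (cosetPt N 0 n)) := by
    unfold perCxi
    rw [hs.tsum_eq_add_tsum_ite 0, h00]
  have hR0 : 0 ≤ ∑' n : ZSite 3, (if n = 0 then (0 : ℝ) else Cxi 3 ξ (cosetPt N 0 n)) :=
    tsum_nonneg fun n => by
      split_ifs
      · exact le_rfl
      · exact Cxi_nonneg hξ _
  have hR1 : ∑' n : ZSite 3, (if n = 0 then (0 : ℝ) else Cxi 3 ξ (cosetPt N 0 n)) ≤ 472500 :=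
    tsum_le_of_sum_le' (by norm_num) (sum_ite_coset_le hξ hξ1 hN)
  constructor <;> linarith

variable {P : Params} {j : ℕ}

/-- **`C^ξ_T(y,y)` versus `C^ξ(0)`** (d = 3, `0 < ξ ≤ 1`, side `ξN ≥ 1`): the diagonal of the torus free propagator (p03's `CxiT`,
the periodization of `C^ξ` at the base point `liftZ y y = 0`) differs from the `ξℤ³` tadpole `C^ξ(0)` by the wrap-around terms only:
`0 ≤ C^ξ_T(y,y) − C^ξ(0) ≤ 472500`, uniformly in `ξ`, the volume and the site. [cite: Balaban1983Higgs3, (3.21) p.438] -/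
theorem CxiT_diag_sub_Cxi_zero (hd : P.d = 3) {ξ : ℝ} (hξ : 0 < ξ) (hξ1 : ξ ≤ 1)
    (hN : 1 ≤ ξ * (P.sitesPerDir j : ℝ)) (y : Site P j) :
    0 ≤ CxiT ξ y y - Cxi P.d ξ 0 ∧ CxiT ξ y y - Cxi P.d ξ 0 ≤ 472500 := by
  have h0 : liftZ y y = 0 := (liftZ_eq_zero_iff y y).2 rfl
  have h1 : CxiT ξ y y = perCxi P.d ξ (P.sitesPerDir j) 0 := by
    show perCxi P.d ξ (P.sitesPerDir j) (liftZ y y) = _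
    rw [h0]
  rw [h1]
  exact perCxi_zero_sub_Cxi_zero hd hξ hξ1 hN

end Wrap

/-! ## §2 The (3.16) split at the diagonal and the `O(η)` comparison with the free tadpole -/

section Split

/-- kernel: `C^ξ(0)` on `ξℤ^d` does not see the ambient `Params.d = 3` bookkeeping. [folklore] -/
private theorem Cxi_zero_congr {d : ℕ} (hd : d = 3) (ξ : ℝ) : Cxi d ξ 0 = Cxi 3 ξ 0 := by
  subst hd; rfl

variable {P : Params}

/-- The (3.16) split `G^ξ_k(0) = C^ξ_T + M` (p39 g6's `Mxi := G0xi − CxiT`) AT THE DIAGONAL, arranged around the `ξℤ³` tadpole: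
`ξ·G^ξ_k(0;y,y) = ξ·C^ξ(0) + ξ·(C^ξ_T(y,y) − C^ξ(0)) + ξ·M(y,y)`. [cite: Balaban1983Higgs3, (3.16) p.437, (3.21) p.438] -/
theorem eta_mul_G0xi_diag_eq (a msq : ℝ) (k : ℕ) (y : Site P 0) :
    P.eta k * G0xi P a msq k y y =
      P.eta k * Cxi P.d (P.eta k) 0 + P.eta k * (CxiT (P.eta k) y y - Cxi P.d (P.eta k) 0) +
        P.eta k * Mxi P a msq k y y := by
  simp only [Mxi]
  ring

/-- **`|ηG_k(y,y) − η·C^η(0)| ≤ C·η`, uniformly in the volume and the scale** (d = 3, zero-field torus instance): for odd `L > 1`,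
`a > 0`, `m² ≥ 0` there is `C > 0` (a function of `L, a, m²` only) such that for EVERY volume `P = (3, L, m, K)`, every `1 ≤ k ≤ K`
and every site `y`, with `η = ξ = L^{−k}`: `|ξ·G^ξ_k(0;y,y) − ξ·C^ξ(0)| ≤ C·ξ` — the coincident-point value of the paper's `ηG_k(0)`
and the free `ξℤ³` tadpole `ξC^ξ(0)` of `B3CxiTadpoleLimit` differ by `O(η)` (`C = 472500 + C_M`: the wrap-around constant of
`CxiT_diag_sub_Cxi_zero` plus p39 g7's uniform bound `|M| ≤ C_M` of `Mxi_profiles`). [cite: Balaban1983Higgs3, (3.21) p.438] -/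
theorem abs_eta_mul_G0xi_diag_sub_le (L : ℕ) (hL : Odd L ∧ 1 < L) {a : ℝ} (ha : 0 < a) {msq : ℝ} (hmsq : 0 ≤ msq) :
    ∃ C : ℝ, 0 < C ∧ ∀ (P : Params), P.d = 3 → P.L = L → ∀ k : ℕ, 1 ≤ k → k ≤ P.K → ∀ y : Site P 0,
      |P.eta k * G0xi P a msq k y y - P.eta k * Cxi 3 (P.eta k) 0| ≤ C * P.eta k := by
  obtain ⟨δ, C, _hδ, hC, H⟩ := Mxi_profiles L hL ha hmsq
  refine ⟨472500 + C, by positivity, fun P hPd hPL k hk1 hkK y => ?_⟩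
  have hM : |Mxi P a msq k y y| ≤ C := (H P hPd hPL k hk1 hkK).1 y y
  have hη : 0 < P.eta k := eta_pos P k
  have hη1 : P.eta k ≤ 1 := eta_le_one P k
  have hkm : k ≤ P.m + P.K := hkK.trans (Nat.le_add_left _ _)
  have hN : 1 ≤ P.eta k * (P.sitesPerDir 0 : ℝ) := one_le_eta_mul_sitesPerDir P hkm
  have hW := CxiT_diag_sub_Cxi_zero (j := 0) hPd hη hη1 hN y
  rw [← Cxi_zero_congr hPd]
  have hid : P.eta k * G0xi P a msq k y y - P.eta k * Cxi P.d (P.eta k) 0 =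
      P.eta k * ((CxiT (P.eta k) y y - Cxi P.d (P.eta k) 0) + Mxi P a msq k y y) := by
    simp only [Mxi]
    ring
  rw [hid, abs_mul, abs_of_pos hη, mul_comm (472500 + C)]
  refine mul_le_mul_of_nonneg_left ?_ hη.le
  calc |CxiT (P.eta k) y y - Cxi P.d (P.eta k) 0 + Mxi P a msq k y y|
      ≤ |CxiT (P.eta k) y y - Cxi P.d (P.eta k) 0| + |Mxi P a msq k y y| := abs_add_le _ _
    _ ≤ 472500 + C := by
        rw [abs_of_nonneg hW.1]
        exact add_le_add hW.2 hM

end Split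

/-! ## §3 The limit `η → 0` (`k → ∞`), uniformly in the volume -/

section Limit

/-- kernel: the `ε`–`δ` form of p20 g4's `tendsto_xi_mul_Cxi_zero_three`: for every `e > 0` there is `δ > 0` with
`|ξ·C^ξ(0) − K₃| < e` for all `0 < ξ < δ`. [cite: Balaban1983Higgs3, (3.21) p.438] -/
theorem xi_mul_Cxi_zero_near {e : ℝ} (he : 0 < e) :
    ∃ δ : ℝ, 0 < δ ∧ ∀ ξ : ℝ, 0 < ξ → ξ < δ → |ξ * Cxi 3 ξ 0 - ((2 * Real.pi)⁻¹ ^ 3 * ∫ q in bzBox 3 1, (lapSymbol 3 1 q)⁻¹)| < e := by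
  have hev : ∀ᶠ ξ in 𝓝[>] (0 : ℝ), |ξ * Cxi 3 ξ 0 - ((2 * Real.pi)⁻¹ ^ 3 * ∫ q in bzBox 3 1, (lapSymbol 3 1 q)⁻¹)| < e := by
    have h := tendsto_xi_mul_Cxi_zero_three (Metric.ball_mem_nhds _ he)
    filter_upwards [h] with ξ hξ
    rw [Set.mem_preimage, Metric.mem_ball, Real.dist_eq] at hξ
    exact hξ
  rw [eventually_nhdsWithin_iff, Metric.eventually_nhds_iff] at hev
  obtain ⟨δ, hδ, hh⟩ := hev
  refine ⟨δ, hδ, fun ξ hξ hξδ => hh ?_ hξ⟩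
  rw [Real.dist_eq, sub_zero, abs_of_pos hξ]
  exact hξδ

/-- kernel: `η = L^{−k}` is eventually small, uniformly in the volume: for `θ > 0` there is `k₀` with `L^{−k} < θ` for all
`k ≥ k₀` (every `P` with `P.L = L`). [cite: Balaban1983Higgs3, (1.1) p.412] -/
theorem eta_lt_of_le {L : ℕ} (hL : 1 < L) {θ : ℝ} (hθ : 0 < θ) :
    ∃ k₀ : ℕ, ∀ (P : Params), P.L = L → ∀ k : ℕ, k₀ ≤ k → P.eta k < θ := by
  have hr0 : 0 ≤ ((L : ℝ))⁻¹ := inv_nonneg.mpr (Nat.cast_nonneg L)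
  have hr1 : ((L : ℝ))⁻¹ < 1 := inv_lt_one_of_one_lt₀ (by exact_mod_cast hL)
  obtain ⟨k₀, hk₀⟩ := exists_pow_lt_of_lt_one hθ hr1
  refine ⟨k₀, fun P hPL k hk => ?_⟩
  have hη : P.eta k = ((L : ℝ))⁻¹ ^ k := by
    unfold Params.eta
    rw [hPL]
  rw [hη]
  exact (pow_le_pow_of_le_one hr0 hr1.le hk).trans_lt hk₀

/-- **p. 438, "ηG_k(x,x) is convergent to some finite constant as η → 0" — THE LIMIT, PROVED at the zero-field torus instance
(d = 3), uniformly in the volume, constant identified**: for odd `L > 1`, `a > 0`, `m² ≥ 0` and every `e > 0` there is `k₀` such that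
for EVERY volume `P = (3, L, m, K)`, every scale `k₀ ≤ k ≤ K` (`1 ≤ k`) and every site `y`:
`|ξ·G^ξ_k(0;y,y) − K₃| < e`, `ξ = η = L^{−k}`, `K₃ = (2π)^{−3}∫_{|q_μ|≤π}dq/Δ¹(q)` — i.e. `ηG_k(y,y) → K₃` as `η = L^{−k} → 0`.
[cite: Balaban1983Higgs3, (3.21) p.438] -/
theorem eta_mul_G0xi_diag_tendsto (L : ℕ) (hL : Odd L ∧ 1 < L) {a : ℝ} (ha : 0 < a) {msq : ℝ} (hmsq : 0 ≤ msq)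
    {e : ℝ} (he : 0 < e) :
    ∃ k₀ : ℕ, ∀ (P : Params), P.d = 3 → P.L = L → ∀ k : ℕ, k₀ ≤ k → 1 ≤ k → k ≤ P.K → ∀ y : Site P 0,
      |P.eta k * G0xi P a msq k y y - ((2 * Real.pi)⁻¹ ^ 3 * ∫ q in bzBox 3 1, (lapSymbol 3 1 q)⁻¹)| < e := by
  obtain ⟨C, hC, HA⟩ := abs_eta_mul_G0xi_diag_sub_le L hL ha hmsq
  obtain ⟨δ, hδ, Hδ⟩ := xi_mul_Cxi_zero_near (half_pos he)
  have hθ : 0 < min δ (e / 2 / C) := lt_min hδ (by positivity)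
  obtain ⟨k₀, Hk₀⟩ := eta_lt_of_le hL.2 hθ
  refine ⟨k₀, fun P hPd hPL k hk0 hk1 hkK y => ?_⟩
  have hη : 0 < P.eta k := eta_pos P k
  have hsmall := Hk₀ P hPL k hk0
  have hηδ : P.eta k < δ := hsmall.trans_le (min_le_left _ _)
  have hηC : C * P.eta k < e / 2 := by
    have h1 : P.eta k < e / 2 / C := hsmall.trans_le (min_le_right _ _)
    calc C * P.eta k < C * (e / 2 / C) := mul_lt_mul_of_pos_left h1 hC
      _ = e / 2 := by field_simp
  have h1 := HA P hPd hPL k hk1 hkK y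
  have h2 := Hδ (P.eta k) hη hηδ
  calc |P.eta k * G0xi P a msq k y y - ((2 * Real.pi)⁻¹ ^ 3 * ∫ q in bzBox 3 1, (lapSymbol 3 1 q)⁻¹)|
      ≤ |P.eta k * G0xi P a msq k y y - P.eta k * Cxi 3 (P.eta k) 0| + |P.eta k * Cxi 3 (P.eta k) 0 - ((2 * Real.pi)⁻¹ ^ 3 * ∫ q in bzBox 3 1, (lapSymbol 3 1 q)⁻¹)| :=
        abs_sub_le _ _ _
    _ < e / 2 + e / 2 := add_lt_add_of_le_of_lt (h1.trans hηC.le) h2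
    _ = e := by ring

/-- **The printed shape: "convergent to SOME finite constant"** — there is a real number `K` (in fact `K = K₃ ∈ [1/12, 3(π+1)/(4π)]`,
finite and NON-ZERO, p20 g4's `tadpoleConst_mem_Icc`) such that `ηG_k(y,y) → K` as `η = L^{−k} → 0`, uniformly in the volume
`(m, K ≥ k)` and the site, at the zero-field torus instance (d = 3). [cite: Balaban1983Higgs3, (3.21) p.438] -/
theorem eta_mul_G0xi_diag_convergent (L : ℕ) (hL : Odd L ∧ 1 < L) {a : ℝ} (ha : 0 < a) {msq : ℝ} (hmsq : 0 ≤ msq) :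
    ∃ K : ℝ, K ∈ Set.Icc (1 / 12 : ℝ) (3 * (Real.pi + 1) / (4 * Real.pi)) ∧
      ∀ e : ℝ, 0 < e → ∃ k₀ : ℕ, ∀ (P : Params), P.d = 3 → P.L = L → ∀ k : ℕ, k₀ ≤ k → 1 ≤ k → k ≤ P.K →
        ∀ y : Site P 0, |P.eta k * G0xi P a msq k y y - K| < e :=
  ⟨_, tadpoleConst_mem_Icc, fun _ he => eta_mul_G0xi_diag_tendsto L hL ha hmsq he⟩

end Limit

/-! ## §4 On the finest torus: the tower `G^η_k = Σ_{i<k}G^η_{(i)}` (p18 g8's dictionary `ε·G^η_k(x,x) = ξ·G^ξ_k(0;x,x)`) -/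

section Tower

/-- **`|ε·G^η_k(x,x) − ξ·C^ξ(0)| ≤ C·ξ`** for the resummed zero-field torus tower `G^η_k = Σ_{i<k}G^η_{(i)}` of the tree's Sect.-3
carriers (p20 g5 `gpiece`, the form in which p18 g8's `expr321a_zero_torus` reads graph (a) of (3.21)), `d = 3`, uniformly in the
volume and `1 ≤ k ≤ K`; `ξ = L^{−k}`. [cite: Balaban1983Higgs3, (3.21) p.438] -/
theorem abs_eps_mul_Gk_diag_sub_le (L : ℕ) (hL : Odd L ∧ 1 < L) {a : ℝ} (ha : 0 < a) {msq : ℝ} (hmsq : 0 ≤ msq) :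
    ∃ C : ℝ, 0 < C ∧ ∀ (P : Params), P.d = 3 → P.L = L → ∀ k : ℕ, 1 ≤ k → k ≤ P.K → ∀ x : Site P 0,
      |P.eps * (∑ i ∈ range k, gpiece P a msq k i) x x - P.eta k * Cxi 3 (P.eta k) 0| ≤ C * P.eta k := by
  obtain ⟨C, hC, H⟩ := abs_eta_mul_G0xi_diag_sub_le L hL ha hmsq
  refine ⟨C, hC, fun P hPd hPL k hk1 hkK x => ?_⟩
  rw [eps_mul_sum_gpiece_diag ha hmsq hPd hk1 x]
  exact H P hPd hPL k hk1 hkK x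

/-- **`ε·G^η_k(x,x) → K₃` as `k → ∞`, uniformly in the volume** — the printed sentence for the resummed zero-field torus tower on the
finest torus (`d = 3`): for every `e > 0` there is `k₀` with `|ε·(Σ_{i<k}G^η_{(i)})(x,x) − K₃| < e` for every volume
`P = (3, L, m, K)`, every `k₀ ≤ k ≤ K`, every site. [cite: Balaban1983Higgs3, (3.21) p.438] -/
theorem eps_mul_Gk_diag_tendsto (L : ℕ) (hL : Odd L ∧ 1 < L) {a : ℝ} (ha : 0 < a) {msq : ℝ} (hmsq : 0 ≤ msq)
    {e : ℝ} (he : 0 < e) :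
    ∃ k₀ : ℕ, ∀ (P : Params), P.d = 3 → P.L = L → ∀ k : ℕ, k₀ ≤ k → 1 ≤ k → k ≤ P.K → ∀ x : Site P 0,
      |P.eps * (∑ i ∈ range k, gpiece P a msq k i) x x - ((2 * Real.pi)⁻¹ ^ 3 * ∫ q in bzBox 3 1, (lapSymbol 3 1 q)⁻¹)| < e := by
  obtain ⟨k₀, H⟩ := eta_mul_G0xi_diag_tendsto L hL ha hmsq he
  refine ⟨k₀, fun P hPd hPL k hk0 hk1 hkK x => ?_⟩
  rw [eps_mul_sum_gpiece_diag ha hmsq hPd hk1 x]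
  exact H P hPd hPL k hk0 hk1 hkK x

end Tower

/-! ## §5 The first graph of (3.21): "The expression corresponding to the first graph is in fact convergent" -/

section Graph321a

variable {P : Params} {j : ℕ} {W : Type u} [NormedAddCommGroup W] [InnerProductSpace ℝ W]

/-- kernel: the expression of graph (a) of (3.21) (p18 g8's `expr321a`: `Σ_μΣ_xη^d·(ηG(x,x))·g(x)·φ(x)·q²(∂^η_μφ′)(x)`) minus the
LOCAL vertex with a constant coefficient `K` in place of `ηG(x,x)` is the same vertex with the coefficient `ηG(x,x) − K`.
[cite: Balaban1983Higgs3, (3.21) p.438] -/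
theorem expr321a_sub_const (η K : ℝ) (q : W →ₗ[ℝ] W) (G : Kernel P j) (g : SiteField P j ℝ) (φ φ' : SiteField P j W) :
    expr321a η q G g φ φ' - ∑ μ : Fin P.d, ∑ x : Site P j, η ^ P.d * (K * g x * ⟪φ x, q (q (pdiff η⁻¹ μ φ' x))⟫) =
      ∑ μ : Fin P.d, ∑ x : Site P j, η ^ P.d * ((η * G x x - K) * g x * ⟪φ x, q (q (pdiff η⁻¹ μ φ' x))⟫) := by
  unfold expr321a
  rw [← Finset.sum_sub_distrib]
  refine Finset.sum_congr rfl fun μ _ => ?_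
  rw [← Finset.sum_sub_distrib]
  refine Finset.sum_congr rfl fun x _ => ?_
  ring

/-- kernel: if the vertex function is within `B` of the constant, `|ηG(x,x) − K| ≤ B`, and `|g| ≤ 1`, then the expression of graph (a)
of (3.21) is within `B·Σ_μΣ_xη^d‖φ(x)‖‖q²(∂^η_μφ′)(x)‖` of the local vertex with coefficient `K`. [cite: Balaban1983Higgs3, (3.21) p.438] -/
theorem abs_expr321a_sub_const_le {η K B : ℝ} (hη : 0 ≤ η) (q : W →ₗ[ℝ] W) (G : Kernel P j) (g : SiteField P j ℝ)
    (hg : ∀ x : Site P j, |g x| ≤ 1) (hGK : ∀ x : Site P j, |η * G x x - K| ≤ B) (φ φ' : SiteField P j W) :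
    |expr321a η q G g φ φ' - ∑ μ : Fin P.d, ∑ x : Site P j, η ^ P.d * (K * g x * ⟪φ x, q (q (pdiff η⁻¹ μ φ' x))⟫)| ≤
      B * ∑ μ : Fin P.d, ∑ x : Site P j, η ^ P.d * (‖φ x‖ * ‖q (q (pdiff η⁻¹ μ φ' x))‖) := by
  rw [expr321a_sub_const, Finset.mul_sum]
  refine (Finset.abs_sum_le_sum_abs _ _).trans (Finset.sum_le_sum fun μ _ => ?_)
  rw [Finset.mul_sum]
  refine (Finset.abs_sum_le_sum_abs _ _).trans (Finset.sum_le_sum fun x _ => ?_)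
  have hB0 : 0 ≤ B := (abs_nonneg _).trans (hGK x)
  rw [abs_mul, abs_of_nonneg (by positivity : (0 : ℝ) ≤ η ^ P.d), abs_mul, abs_mul]
  have hi : |⟪φ x, q (q (pdiff η⁻¹ μ φ' x))⟫| ≤ ‖φ x‖ * ‖q (q (pdiff η⁻¹ μ φ' x))‖ := abs_real_inner_le_norm _ _
  have hprod : |η * G x x - K| * |g x| ≤ B * 1 := mul_le_mul (hGK x) (hg x) (abs_nonneg _) hB0
  have hηd : 0 ≤ η ^ P.d := by positivity
  calc η ^ P.d * (|η * G x x - K| * |g x| * |⟪φ x, q (q (pdiff η⁻¹ μ φ' x))⟫|)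
      ≤ η ^ P.d * (B * 1 * (‖φ x‖ * ‖q (q (pdiff η⁻¹ μ φ' x))‖)) :=
        mul_le_mul_of_nonneg_left (mul_le_mul hprod hi (abs_nonneg _) (by positivity)) hηd
    _ = B * (η ^ P.d * (‖φ x‖ * ‖q (q (pdiff η⁻¹ μ φ' x))‖)) := by ring

/-- **(3.21), first graph, at the zero-field torus instance (d = 3): the vertex function `ηG_k(x,x)g(x)` versus the free tadpole** —
for odd `L > 1`, `a > 0`, `m² ≥ 0` there is `C > 0` such that for every volume, every `1 ≤ k ≤ K`, every charge matrix `q`, every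
localization `|g| ≤ 1` and all fields `φ, φ′`:
`|expr321a[G^η_k] − Σ_μΣ_xη^d·(ξC^ξ(0))·g(x)·φ(x)·q²(∂^η_μφ′)(x)| ≤ C·ξ·Σ_μΣ_xη^d‖φ(x)‖‖q²(∂^η_μφ′)(x)‖`, `ξ = L^{−k}`.
[cite: Balaban1983Higgs3, (3.21) p.438] -/
theorem abs_expr321a_sub_free_le (L : ℕ) (hL : Odd L ∧ 1 < L) {a : ℝ} (ha : 0 < a) {msq : ℝ} (hmsq : 0 ≤ msq) :
    ∃ C : ℝ, 0 < C ∧ ∀ (P : Params), P.d = 3 → P.L = L → ∀ k : ℕ, 1 ≤ k → k ≤ P.K →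
      ∀ {W : Type u} [NormedAddCommGroup W] [InnerProductSpace ℝ W] (q : W →ₗ[ℝ] W) (g : SiteField P 0 ℝ)
        (φ φ' : SiteField P 0 W), (∀ x, |g x| ≤ 1) →
        |expr321a P.eps q (∑ i ∈ range k, gpiece P a msq k i) g φ φ' -
            ∑ μ : Fin P.d, ∑ x : Site P 0, P.eps ^ P.d *
              (P.eta k * Cxi 3 (P.eta k) 0 * g x * ⟪φ x, q (q (pdiff P.eps⁻¹ μ φ' x))⟫)| ≤
          C * P.eta k * ∑ μ : Fin P.d, ∑ x : Site P 0, P.eps ^ P.d * (‖φ x‖ * ‖q (q (pdiff P.eps⁻¹ μ φ' x))‖) := by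
  obtain ⟨C, hC, H⟩ := abs_eps_mul_Gk_diag_sub_le L hL ha hmsq
  refine ⟨C, hC, fun P hPd hPL k hk1 hkK W _ _ q g φ φ' hg => ?_⟩
  exact abs_expr321a_sub_const_le P.eps_pos.le q _ g hg (fun x => H P hPd hPL k hk1 hkK x) φ φ'

/-- **p. 438, "The expression corresponding to the first graph is in fact convergent, because ηG_k(x,x) is convergent to some
finite constant as η → 0" — PROVED at the zero-field torus instance (d = 3), uniformly in the volume**: for odd `L > 1`, `a > 0`,
`m² ≥ 0` and every `e > 0` there is `k₀` such that for every volume `P = (3, L, m, K)`, every `k₀ ≤ k ≤ K`, every charge matrix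
`q`, every localization `|g| ≤ 1` and all fields `φ, φ′`, the expression of graph (a) of (3.21) on the resummed tower `G^η_k`
differs from the LOCAL vertex `Σ_μΣ_xη^d·K₃·g(x)·φ(x)·q²(∂^η_μφ′)(x)` with the LIMIT constant `K₃` by at most
`e·Σ_μΣ_xη^d‖φ(x)‖‖q²(∂^η_μφ′)(x)‖` — the vertex function `ηG_k(x,x)g(x)` converges to `K₃·g(x)` uniformly in `x`.
[cite: Balaban1983Higgs3, (3.21) p.438] -/
theorem expr321a_zero_torus_tendsto (L : ℕ) (hL : Odd L ∧ 1 < L) {a : ℝ} (ha : 0 < a) {msq : ℝ} (hmsq : 0 ≤ msq)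
    {e : ℝ} (he : 0 < e) :
    ∃ k₀ : ℕ, ∀ (P : Params), P.d = 3 → P.L = L → ∀ k : ℕ, k₀ ≤ k → 1 ≤ k → k ≤ P.K →
      ∀ {W : Type u} [NormedAddCommGroup W] [InnerProductSpace ℝ W] (q : W →ₗ[ℝ] W) (g : SiteField P 0 ℝ)
        (φ φ' : SiteField P 0 W), (∀ x, |g x| ≤ 1) →
        |expr321a P.eps q (∑ i ∈ range k, gpiece P a msq k i) g φ φ' -
            ∑ μ : Fin P.d, ∑ x : Site P 0, P.eps ^ P.d * (((2 * Real.pi)⁻¹ ^ 3 * ∫ q in bzBox 3 1, (lapSymbol 3 1 q)⁻¹) * g x * ⟪φ x, q (q (pdiff P.eps⁻¹ μ φ' x))⟫)| ≤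
          e * ∑ μ : Fin P.d, ∑ x : Site P 0, P.eps ^ P.d * (‖φ x‖ * ‖q (q (pdiff P.eps⁻¹ μ φ' x))‖) := by
  obtain ⟨k₀, H⟩ := eps_mul_Gk_diag_tendsto L hL ha hmsq he
  refine ⟨k₀, fun P hPd hPL k hk0 hk1 hkK W _ _ q g φ φ' hg => ?_⟩
  exact abs_expr321a_sub_const_le P.eps_pos.le q _ g hg (fun x => (H P hPd hPL k hk0 hk1 hkK x).le) φ φ'

end Graph321a

end

end Literature.MathematicalPhysics.QuantumFieldTheory.Balaban1983to89.B3GkTadpoleLimitZeroTorus
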